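import Summits.Langlands.Langlands.Theses.ClassicalityWeightSplit

/-!
# Route ClassicalityWeightSplit — Assembly

The assembly item (stmt-Langlands-26949) of the child route `ClassicalityWeightSplit` (decomp-langlands lens-2 gen 17; the first gate-native
D-0170 refining child: `--refines route-Langlands-DepthPrimeSplit:Classicality`, edge split, depth 1, no FRAME item) for the crux
CLASS = `DepthPrimeSplit.Classicality` (stmt-Langlands-25026):
`RegularClassicality → WallClassicality → DegenerateClassicality → DepthPrimeSplit.Classicality`.

This is literally the type of the route file's sorry-free deciding theorem `Summit.Langlands.Langlands.Theses.ClassicalityWeightSplit.closes`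
(two excluded middles on the Hodge–Tate-multiplicity trichotomy regular / wall / degenerate).  Nothing here proves `Langlands` (nor CLASS):
the assembly records only that the three ledger items of the route, taken together, imply the refined crux.
-/

set_option linter.dupNamespace false -- project-wide option (lakefile weak.linter.dupNamespace); `Summit.Langlands.Langlands` is the mandated namespace

namespace Summit.Langlands.Langlands.Theorems

/-- **Assembly of route ClassicalityWeightSplit** (stmt-Langlands-26949): `CG → CW → CD → DepthPrimeSplit.Classicality`.  Proof: unfold `Assembly`
and apply the route's deciding theorem `Theses.ClassicalityWeightSplit.closes`. -/
theorem classicalityWeightSplit_assembly_proof :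
    Summit.Langlands.Langlands.Theses.ClassicalityWeightSplit.Assembly := by
  unfold Summit.Langlands.Langlands.Theses.ClassicalityWeightSplit.Assembly
  exact Summit.Langlands.Langlands.Theses.ClassicalityWeightSplit.closes

end Summit.Langlands.Langlands.Theorems
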